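import Mathlib
import Summits.Ventures.PercRepro2.HCov
import Summits.Ventures.PercRepro2.GcSkelRules
import Summits.Ventures.PercRepro2.GcSkelReductionT
import Summits.Ventures.PercRepro2.GcSkelShapeT
import Summits.Ventures.PercRepro2.GcSkelReductionMin
import Summits.Ventures.PercRepro2.GcSkelShapeZ
import Summits.Ventures.PercRepro2.GcHatConn
import Summits.Ventures.PercRepro2.GcSkelReductionHat
import Summits.Ventures.PercRepro2.GcSkelShapeHat
import Summits.Ventures.PercRepro2.GcBundleConn
import Summits.Ventures.PercRepro2.GcBundle
import Summits.Ventures.PercRepro2.GcSkelReductionBundle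

/-!
# The neighbourhoods of the class of record with no root bundle (blind cell PercRepro2, typer-1 g57)

The root-bundle clause read at a single vertex: an unmarked vertex `u` whose non-loop edges all
go to `a₁`, `a₂` and one further vertex `v` is the bundle `W = {u}` (`hasBundle_of_single`), so on
the class of record

* **`exists_two_nonroot_nbrs_of_wredMinHAZB`** — every ACTIVE unmarked vertex carries non-loop
  edges to two DISTINCT vertices outside the roots (its neighbourhood off `{a₁, a₂}` has at least
  two elements) — the sharpening of `deg_ge_four_of_wredMinHAZH` (an unmarked vertex on both roots
  has degree `≥ 4`): its two further edges go to two different vertices.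

In particular on seven vertices (the smallest members of the class, `shape_of_wredMinHAZB`: two
active unmarked vertices `x, y`) each of `x, y` sees at least two of `{o, b, a₃}` and the other
unmarked vertex. Standard axioms.
-/

namespace Summit.Ventures.PercRepro2

open CovForm RECM

namespace WRed

section Single

variable {V : Type*} {E : Type*} [Fintype E] [DecidableEq E] [DecidableEq V]

omit [DecidableEq E] in
/-- **A vertex whose non-loop edges all go to the roots and one further vertex is a bundle**:
`W = {u}` with terminals `a₁, a₂, v`, as soon as `u` is unmarked with at least three non-loop
edges. -/
lemma hasBundle_of_single {ends : E → Sym2 V} {o a₁ a₂ a₃ b u v : V}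
    (hu : Unmarked o a₁ a₂ a₃ b u) (hvu : v ≠ u) (hv1 : v ≠ a₁) (hv2 : v ≠ a₂)
    (hP : ∀ e ∈ edgesAt ends u, ∀ x, ends e = s(u, x) → x = a₁ ∨ x = a₂ ∨ x = v)
    (hdeg : 3 ≤ nonLoopDeg ends u) : Bundle.HasBundle ends o a₁ a₂ a₃ b := by
  -- the other end of a non-loop edge at `u` is `a₁`, `a₂` or `v`
  have hother : ∀ e ∈ edgesAt ends u, ∀ x y, ends e = s(x, y) →
      (x = u ∧ (y = a₁ ∨ y = a₂ ∨ y = v)) ∨ (y = u ∧ (x = a₁ ∨ x = a₂ ∨ x = v)) := by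
    intro e he x y hxy
    obtain ⟨hue, _⟩ := mem_edgesAt.1 he
    rw [hxy, Sym2.mem_iff] at hue
    rcases hue with rfl | rfl
    · exact Or.inl ⟨rfl, hP e he y hxy⟩
    · exact Or.inr ⟨rfl, hP e he x (by rw [hxy, Sym2.eq_swap])⟩
  obtain ⟨eA, hA, eB, hB, e₃, h3, hAB, hA3, hB3⟩ :=
    Finset.two_lt_card.1 (show 2 < (edgesAt ends u).card from hdeg)
  have htouch : ∀ e ∈ edgesAt ends u, e ∈ touches ends {u} := by
    intro e he
    obtain ⟨hue, _⟩ := mem_edgesAt.1 he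
    obtain ⟨y, hy⟩ := Sym2.mem_iff_exists.1 hue
    exact ⟨u, rfl, y, hy⟩
  refine ⟨{u}, v, ⟨?_, ?_, ?_, ?_⟩, ?_, hv1, hv2, eA, eB, e₃, hAB, hA3, hB3, htouch eA hA,
    htouch eB hB, htouch e₃ h3, (mem_edgesAt.1 hA).2, (mem_edgesAt.1 hB).2, (mem_edgesAt.1 h3).2⟩
  · simpa using hu.2.1.symm
  · simpa using hu.2.2.1.symm
  · simpa using hvu
  · intro e he x y hxy
    obtain ⟨z, hz, y', hz'⟩ := he
    have hzu : z = u := hz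
    rw [hzu] at hz'
    by_cases hd : (ends e).IsDiag
    · -- a loop at `u`
      rw [hxy, Sym2.mk_isDiag_iff] at hd
      subst hd
      have hux : u ∈ s(x, x) := by rw [← hxy, hz']; simp
      rw [Sym2.mem_iff, or_self] at hux
      subst hux
      simp
    · have he : e ∈ edgesAt ends u := mem_edgesAt.2 ⟨by rw [hz']; simp, hd⟩
      rcases hother e he x y hxy with ⟨rfl, hy⟩ | ⟨rfl, hx⟩
      · exact ⟨by simp, by rcases hy with rfl | rfl | rfl <;> simp⟩
      · exact ⟨by rcases hx with rfl | rfl | rfl <;> simp, by simp⟩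
  · intro y hy
    rw [Set.mem_singleton_iff] at hy
    subst hy
    exact hu

end Single

section Neighbours

variable {V : Type*} {E : Type*} [Fintype E] [DecidableEq E] [DecidableEq V]

/-- **On the class of record every active unmarked vertex has two distinct non-root
neighbours**: non-loop edges `e = {u, x}`, `f = {u, y}` with `x ≠ y`, `x, y ∉ {a₁, a₂}`. -/
theorem exists_two_nonroot_nbrs_of_wredMinHAZB {ends : E → Sym2 V} {o a₁ a₂ a₃ b u : V}
    (h : WReducedMinHAZB ends o a₁ a₂ a₃ b)
    (h12 : a₁ ≠ a₂) (h13 : a₁ ≠ a₃) (h23 : a₂ ≠ a₃) (ho1 : o ≠ a₁) (ho2 : o ≠ a₂) (ho3 : o ≠ a₃)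
    (hob : o ≠ b) (hb1 : b ≠ a₁) (hb2 : b ≠ a₂) (hb3 : b ≠ a₃)
    (hu : Unmarked o a₁ a₂ a₃ b u) (hact : ∃ e, u ∈ ends e ∧ ¬ (ends e).IsDiag) :
    ∃ (e f : E) (x y : V), ends e = s(u, x) ∧ ends f = s(u, y) ∧ x ≠ y ∧ x ≠ u ∧ y ≠ u ∧
      x ≠ a₁ ∧ x ≠ a₂ ∧ y ≠ a₁ ∧ y ≠ a₂ := by
  -- the degree is at least three
  have hdeg : 3 ≤ nonLoopDeg ends u := by
    have hs := (shape_of_wredMinHAZH (wredMinHAZH_of_wredMinHAZB h) h12 h13 h23 ho1 ho2 ho3 hob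
      hb1 hb2 hb3).1.2.1 u hu
    rcases hs with h0 | h3
    · exfalso
      obtain ⟨e, hue, hd⟩ := hact
      have : e ∈ edgesAt ends u := mem_edgesAt.2 ⟨hue, hd⟩
      have : 0 < nonLoopDeg ends u := Finset.card_pos.2 ⟨e, this⟩
      omega
    · exact h3
  -- the other end of a non-loop edge at `u` is not `u`
  have hne : ∀ e ∈ edgesAt ends u, ∀ x, ends e = s(u, x) → x ≠ u := by
    intro e he x hx hxu
    obtain ⟨_, hd⟩ := mem_edgesAt.1 he
    rw [hx, hxu, Sym2.mk_isDiag_iff] at hd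
    exact hd rfl
  by_cases hx : ∃ e ∈ edgesAt ends u, ∃ x, ends e = s(u, x) ∧ x ≠ a₁ ∧ x ≠ a₂
  · obtain ⟨e, he, x, hex, hx1, hx2⟩ := hx
    have hxu : x ≠ u := hne e he x hex
    by_cases hy : ∃ f ∈ edgesAt ends u, ∃ y, ends f = s(u, y) ∧ y ≠ a₁ ∧ y ≠ a₂ ∧ y ≠ x
    · obtain ⟨f, hf, y, hfy, hy1, hy2, hyx⟩ := hy
      exact ⟨e, f, x, y, hex, hfy, hyx.symm, hxu, hne f hf y hfy, hx1, hx2, hy1, hy2⟩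
    · -- every non-loop edge at `u` goes to `a₁`, `a₂` or `x`: the bundle `{u}`
      exfalso
      push Not at hy
      refine h.noBundle (hasBundle_of_single hu hxu hx1 hx2 (fun f hf y hfy => ?_) hdeg)
      by_cases hy1 : y = a₁
      · exact Or.inl hy1
      by_cases hy2 : y = a₂
      · exact Or.inr (Or.inl hy2)
      exact Or.inr (Or.inr (hy f hf y hfy hy1 hy2))
  · -- every non-loop edge at `u` goes to a root: the bundle `{u}` with `v = a₃`
    exfalso
    push Not at hx
    refine h.noBundle (hasBundle_of_single hu hu.2.2.2.1.symm h13.symm h23.symm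
      (fun e he x hex => ?_) hdeg)
    by_cases hx1 : x = a₁
    · exact Or.inl hx1
    exact Or.inr (Or.inl (hx e he x hex hx1))

end Neighbours

end WRed

end Summit.Ventures.PercRepro2
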